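import Literature.LinearAlgebra.TensorNetworks.QTTLaplaceInverse

/-!
# Powers of the cyclic shift have QTT ranks two (addition with carry), and circulant / Toeplitz
# matrices generated by QTT vectors have QTT ranks `2r` (Kazeev–Khoromskij–Tyrtyshnikov, Lem. 3.2;
# Vysotsky–Rakhuba, Lem. 4.2 and §8)

This file continues the explicit QTT matrix representations of
`Literature.LinearAlgebra.TensorNetworks.QTTLaplace` (shift, gradient and Laplace matrices,
[KazeevKhoromskij2012]) with the SHIFT POWERS and the matrices they generate:

* (LEMMA 3.2 of [KazeevKhoromskijTyrtyshnikov2013], as quoted VERBATIM in Lem. 4.2 of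
  [VysotskyRakhuba2022] — "Lemma 4.2 ([khkaz-conv-2013], Lemma 3.2)", `khkaz-conv-2013` being
  that text's key for the 2013 paper; the 2013 text itself was not available to us, so every
  citation tag of this part points to the quotation we read)
  for `L ≥ 2` and every `i = 2^{L-1} i_L + ⋯ + 2 i_2 + i_1`, the `i`-th
  power of the CYCLIC PERMUTATION MATRIX `P_L` of size `2^L` (ones on the subdiagonal and in the
  top right corner, `cyclicShiftP`) has the rank-`(2, …, 2)` QTT representation
  `P_L^i = U_{i_L} ⋈ V_{i_{L-1}} ⋈ ⋯ ⋈ V_{i_2} ⋈ W_{i_1}` with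
  `U_0 = [I H]`, `U_1 = [H I]`, `V_0 = [I J'; 0 J]`, `V_1 = [J' 0; J I]`, `W_0 = [I; 0]`,
  `W_1 = [J'; J]`, `I = [1 0; 0 1]`, `J = [0 1; 0 0]`, `J' = [0 0; 1 0]` (and `H = J + J'`, which the
  quoting text uses without display; this reading is CERTIFIED here by the kernel:
  `vecMul_addCore_two_zero`, `pow_cyclicShiftP_eq_addU_mul_chainProd_mul_addW`).
  MECHANISM (this file's rendering, for an arbitrary base `b`): the entry
  `P^p(m, n) = 𝟙[m ≡ n + p (mod b^R)]` is decided by ADDING `n + p` DIGIT BY DIGIT WITH CARRY from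
  the least significant end; the carry is one bit, so the automaton reading the digit triples
  `(p_r, m_r, n_r)` has two states — the `2 × 2` ADDER CORE `addCore a (i, j) = (𝟙[i + b c' = j + a + c])_{c', c}`
  (`c` = incoming carry, `c'` = outgoing carry; for `b = 2`, `a = 0, 1` these are `V_0`, `V_1`:
  `addCore_two_zero`, `addCore_two_one`), the right boundary `(1, 0)ᵀ` (no carry into the last
  digit: `W_a = V_a (1, 0)ᵀ`) and the left boundary `(1, 1)` (sum of the unwrapped part
  `𝟙[m = n + p]` and the wrapped part `𝟙[m + b^R = n + p]`: `U_a = (1, 1) V_a`); the boundary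
  `(1, 0)` instead gives the (nilpotent) powers of the non-periodic down-shift `Sᵀ`
  (`qttMatrix_shiftPowTrain_lower`, `transpose_shiftS_pow`).  Main statements:
  `mulVec_chainProd_addCore` (the automaton), `eval_adderTrain` / `eval_adderTrain_periodic`
  (the three-leg SHIFT TENSOR `(p, m, n) ↦ 𝟙[m - n = p]` has TT ranks two),
  `qttMatrix_shiftPowTrain_periodic : … = Matrix.circulant (Pi.single p 1)`,
  `qttMatrix_shiftPowTrain_eq_pow : … = cyclicShiftP ^ p`.
* (CIRCULANT AND TOEPLITZ MATRICES GENERATED BY QTT VECTORS; §8 of [VysotskyRakhuba2022], the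
  proof of Prop. 4.1: `C = Σ_i x_i P_L^i` "and the polylinearity of the TT decomposition" give
  "an explicit QTT representation with all ranks equal to `2r`"; the construction is credited
  there to [KazeevKhoromskijTyrtyshnikov2013]: "In [khkaz-conv-2013], the QTT rank bounds and
  explicit formulas were derived for multilevel Toeplitz and circulant matrices", "apply the
  result from [khkaz-conv-2013] to generate a QTT representation of a circulant matrix from its
  first column in the QTT format") the generic format
  operations `TensorTrain.comap` (relabel legs), `TensorTrain.sumFst` (sum a leg component out:
  POLYLINEARITY, `eval_sumFst`) and `TensorTrain.contract` (contract a QTT vector `x` on legs `α`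
  with a train on legs `α × β` along the shared leg; bond dimensions multiply: `contract_r`), and
  `qttMatrix_contract_adderTrain_periodic : (x ×₁ adder).qttMatrix = Matrix.circulant x`
  (ranks `2 r_ℓ`), the lower / strictly-upper triangular parts
  (`qttMatrix_contract_adderTrain_lower`, `_upper`) and hence every TOEPLITZ matrix
  `T(m, n) = c_{m-n} (m ≥ n), u_{N+m-n} (m < n)` from QTT vectors `c`, `u` with ranks
  `2 r_ℓ(c) + 2 r_ℓ(u)` (`qttMatrix_toeplitzTrain`).

CONVENTIONS.  As in the files cited above: sites are ordered MOST SIGNIFICANT DIGIT FIRST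
(`quanticsEquiv`; the quoting paper's first core `U_{i_L}` carries the digit of weight `2^{L-1}`,
its last core `W_{i_1}` the units digit, so the orders agree), trains carry boundary vectors
(`TensorTrain.uniform`), and a representation "for `L ≥ 2`" with distinguished first/last cores
is rendered uniformly for every `R ≥ 0` with the first/last cores recovered as
`boundary ⋈ core` (`addU_eq`, `addW_eq`); matrix entries are indexed from `0`.

NOT FORMALISED HERE: the multilevel (block) case and the precise statements of
[KazeevKhoromskijTyrtyshnikov2013] itself (its text was not available to us, only the quotations
in [VysotskyRakhuba2022]; here a
Toeplitz matrix is generated by its lower and upper QTT vectors separately, ranks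
`2 r_ℓ(c) + 2 r_ℓ(u)`); the rank reduction `(2, r+1, …, r+1)` of [VysotskyRakhuba2022, Prop. 4.1];
approximate (ε-rank) statements.
-/

open Matrix Finset

namespace Literature.LinearAlgebra.TensorNetworks

universe u

/-! ### Polylinearity of the format: relabelling legs, summing a leg component out, contraction -/

namespace TensorTrain

variable {K : Type u} [CommSemiring K] {α β : Type*} {L : ℕ}

/-- RELABELLING THE LEGS of a train along `φ : β → α`: cores `M_ℓ^{φ(c)}`, same bond dimensions
and boundary vectors (the train read along `φ ∘ t`; bookkeeping for the polylinearity argument).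
[cite: VysotskyRakhuba2022, §8 (proof of Prop. 4.1)] -/
abbrev comap (φ : β → α) (T : TensorTrain K α L) : TensorTrain K β L where
  r := T.r
  core := fun ℓ c => T.core ℓ (φ c)
  lbdry := T.lbdry
  rbdry := T.rbdry

/-- Partial products of the relabelled train (bookkeeping).  [cite: VysotskyRakhuba2022, §8 (proof of Prop. 4.1)] -/
theorem leftProd_comap (φ : β → α) (T : TensorTrain K α L) :
    ∀ (k : ℕ) (t : Fin k → β), (T.comap φ).leftProd k t = T.leftProd k (φ ∘ t)
  | 0, _ => rfl
  | k + 1, t => by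
      rw [leftProd_succ, leftProd_succ, leftProd_comap φ T k (Fin.init t)]
      rfl

/-- The relabelled train represents the relabelled tensor: `(T ∘ φ)(t) = T(φ ∘ t)`.
[cite: VysotskyRakhuba2022, §8 (proof of Prop. 4.1)] -/
theorem eval_comap (φ : β → α) (T : TensorTrain K α L) (t : Fin L → β) :
    (T.comap φ).eval t = T.eval (φ ∘ t) := by
  rw [eval, eval, leftProd_comap]

/-- SUMMING OUT THE FIRST LEG COMPONENT in the format: from a train on legs `α × β`, the train on
legs `β` with the summed cores `N_ℓ^c = Σ_a M_ℓ^{(a, c)}` and the same bond dimensions and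
boundary vectors.  [cite: VysotskyRakhuba2022, §8 (proof of Prop. 4.1)] -/
abbrev sumFst [Fintype α] (S : TensorTrain K (α × β) L) : TensorTrain K β L where
  r := S.r
  core := fun ℓ c => ∑ a, S.core ℓ (a, c)
  lbdry := S.lbdry
  rbdry := S.rbdry

/-- [folklore] Appending a site to a configuration of pairs (bookkeeping). -/
private theorem pair_snoc {k : ℕ} (s : Fin k → α) (a : α) (t : Fin (k + 1) → β) :
    (fun i => (Fin.snoc (α := fun _ => α) s a i, t i)) =
      Fin.snoc (α := fun _ => α × β) (fun i => (s i, Fin.init t i)) (a, t (Fin.last k)) := by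
  funext i
  refine Fin.lastCases ?_ (fun j => ?_) i
  · simp
  · simp [Fin.init]

/-- POLYLINEARITY OF THE TT DECOMPOSITION at the level of partial products: the partial products of
the summed train are the sums, over the strings of first components, of the partial products,
`N_0^{t_0} ⋯ N_{k-1}^{t_{k-1}} = Σ_s M_0^{(s_0,t_0)} ⋯ M_{k-1}^{(s_{k-1},t_{k-1})}`.
[cite: VysotskyRakhuba2022, §8 (proof of Prop. 4.1)] -/
theorem leftProd_sumFst [Fintype α] (S : TensorTrain K (α × β) L) : ∀ (k : ℕ) (t : Fin k → β),
    S.sumFst.leftProd k t = ∑ s : Fin k → α, S.leftProd k fun i => (s i, t i)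
  | 0, _ => by simp
  | k + 1, t => by
      have hc : S.sumFst.core k (t (Fin.last k)) = ∑ a, S.core k (a, t (Fin.last k)) := rfl
      have hsnoc : ∀ (a : α) (s : Fin k → α),
          (Fin.snocEquiv fun _ : Fin (k + 1) => α) (a, s) = Fin.snoc s a := fun _ _ => rfl
      rw [leftProd_succ, hc, leftProd_sumFst S k (Fin.init t), Matrix.sum_mul,
        ← (Fin.snocEquiv fun _ : Fin (k + 1) => α).sum_comp, Fintype.sum_prod_type]
      conv_rhs => rw [Finset.sum_comm]
      refine Finset.sum_congr rfl fun s _ => ?_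
      rw [Matrix.mul_sum]
      refine Finset.sum_congr rfl fun a _ => ?_
      rw [hsnoc, pair_snoc, leftProd_snoc]

/-- POLYLINEARITY OF THE TT DECOMPOSITION: summing the cores over a leg component at every site
sums the represented tensor over all strings of that component,
`N(t) = Σ_s M((s_0, t_0), …, (s_{L-1}, t_{L-1}))` — the step "use … the polylinearity of the TT
decomposition: `Σ_{i_1…i_L} Σ_t α_t z_t^{(…)} U_{i_L} ⋈ ⋯ ⋈ W_{i_1} = Σ_t (Σ_{i_L} z_t^{2^{L-1} i_L} U_{i_L}) ⋈ ⋯`"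
of the cited proof.  [cite: VysotskyRakhuba2022, §8 (proof of Prop. 4.1)] -/
theorem eval_sumFst [Fintype α] (S : TensorTrain K (α × β) L) (t : Fin L → β) :
    S.sumFst.eval t = ∑ s : Fin L → α, S.eval fun i => (s i, t i) := by
  simp only [eval]
  rw [leftProd_sumFst, Matrix.sum_mulVec, dotProduct_sum]

/-- CONTRACTION ALONG A SHARED LEG in the format (mode product of a TT vector with a TT tensor of
one more leg): for a train `T` on legs `α` (a vector `x_s`) and a train `T'` on legs `α × β`
(a tensor `S_{s,t}`), the train on legs `β` with cores `Σ_a M_ℓ^a ⊗ M'_ℓ^{(a,c)}`, bond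
dimensions `r_ℓ · r'_ℓ` and Kronecker boundary vectors; it represents `t ↦ Σ_s x_s S_{s,t}`
(`eval_contract`).  [cite: VysotskyRakhuba2022, §8 (proof of Prop. 4.1)] -/
abbrev contract [Fintype α] (T : TensorTrain K α L) (T' : TensorTrain K (α × β) L) :
    TensorTrain K β L :=
  ((T.comap Prod.fst).hadamard T').sumFst

/-- The bond dimensions of the contraction are the products `r_ℓ · r'_ℓ` ("ranks `2r`" when
`r' = 2`).  [cite: VysotskyRakhuba2022, §8 (proof of Prop. 4.1)] -/
theorem contract_r [Fintype α] (T : TensorTrain K α L) (T' : TensorTrain K (α × β) L) (ℓ : ℕ) :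
    (T.contract T').r ℓ = T.r ℓ * T'.r ℓ := rfl

/-- THE CONTRACTED TRAIN REPRESENTS THE CONTRACTION: `(x ×₁ S)(t) = Σ_s x(s) · S(s, t)`
(Hadamard product in the format, then polylinearity).  [cite: VysotskyRakhuba2022, §8 (proof of Prop. 4.1)] -/
theorem eval_contract [Fintype α] (T : TensorTrain K α L) (T' : TensorTrain K (α × β) L)
    (t : Fin L → β) :
    (T.contract T').eval t = ∑ s : Fin L → α, T.eval s * T'.eval fun i => (s i, t i) := by
  rw [contract, eval_sumFst]
  refine Finset.sum_congr rfl fun s _ => ?_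
  rw [eval_hadamard, eval_comap]
  rfl

/-- A chain with site-dependent cores `G(a_ℓ, ·)` is the chain of the two-leg core `G` read along
the paired string `(a_r, g_r)` (bookkeeping).  [cite: VysotskyRakhuba2022, §8 (proof of Prop. 4.1)] -/
theorem chainProd_curry {τ σ : Type*} {n : ℕ} (G : τ → σ → Matrix (Fin n) (Fin n) K) (a : ℕ → τ) :
    ∀ (k : ℕ) (g : Fin k → σ),
      chainProd (fun ℓ c => G (a ℓ) c) k g = chainProd (fun _ (t : τ × σ) => G t.1 t.2) k
        (fun r => (a r, g r))
  | 0, _ => rfl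
  | k + 1, g => by
      rw [chainProd, chainProd, chainProd_curry G a k (Fin.init g)]
      rfl

end TensorTrain

/-! ### Lemma 3.2: addition with carry — the shift tensor and the shift powers have QTT ranks two -/

section ShiftPowers

variable (K : Type u) [CommSemiring K] {b : ℕ}

/-- THE ADDER CORE at the exponent digit `a` and the mode pair `(i, j)` (row digit, column digit):
the `2 × 2` matrix `(c', c) ↦ 𝟙[i + b·c' = j + a + c]` of the CARRY AUTOMATON of the column
addition `n + p = m` in base `b` (column index `c` = the carry coming in from the less significant
digits, row index `c'` = the carry passed on); for `b = 2` the blocks `V_0 = [I J'; 0 J]`,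
`V_1 = [J' 0; J I]` of the cited Lemma (`addCore_two_zero`, `addCore_two_one`).
[cite: VysotskyRakhuba2022, Lem. 4.2] -/
def addCore (a : Fin b) (p : Fin b × Fin b) : Matrix (Fin 2) (Fin 2) K :=
  Matrix.of fun c' c : Fin 2 => if (p.1 : ℕ) + b * c' = p.2 + a + c then 1 else 0

/-- The state of the carry automaton after the `k` least significant digits (`N = b^k`,
`p, m, n < N` the numbers read so far): `(𝟙[m = n + p], 𝟙[m + N = n + p])` = (the column sums
match with no carry out, … with a carry out).  [cite: VysotskyRakhuba2022, Lem. 4.2] -/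
def addVec (N p m n : ℕ) : Fin 2 → K :=
  ![if m = n + p then 1 else 0, if m + N = n + p then 1 else 0]

variable {K}

/-- [folklore] Base-`B` arithmetic of one more digit: for `m < B` and `s < 2B`,
`X·B + m = Y·B + s ↔ (m = s ∧ X = Y) ∨ (m + B = s ∧ X = Y + 1)` (bookkeeping). -/
private theorem mul_add_eq_iff {B X Y m s : ℕ} (hm : m < B) (hs : s < 2 * B) :
    X * B + m = Y * B + s ↔ (m = s ∧ X = Y) ∨ (m + B = s ∧ X = Y + 1) := by
  have hB : 0 < B := by omega
  constructor
  · intro h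
    have hdiv : (X * B + m) / B = (Y * B + s) / B := by rw [h]
    have hmod : (X * B + m) % B = (Y * B + s) % B := by rw [h]
    rw [Nat.mul_comm X B, Nat.mul_comm Y B, Nat.mul_add_div hB, Nat.mul_add_div hB,
      Nat.div_eq_of_lt hm] at hdiv
    rw [Nat.mul_comm X B, Nat.mul_comm Y B, Nat.mul_add_mod, Nat.mul_add_mod,
      Nat.mod_eq_of_lt hm] at hmod
    rcases Nat.lt_or_ge s B with hsB | hsB
    · rw [Nat.div_eq_of_lt hsB] at hdiv
      rw [Nat.mod_eq_of_lt hsB] at hmod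
      omega
    · rw [Nat.div_eq_of_lt_le (k := 1) (by omega) (by omega)] at hdiv
      rw [Nat.mod_eq_sub_mod hsB, Nat.mod_eq_of_lt (show s - B < B by omega)] at hmod
      omega
  · rintro (⟨rfl, rfl⟩ | ⟨rfl, rfl⟩)
    · rfl
    · ring

/-- [folklore] Two exclusive indicator products add up to the indicator of the disjunction
(bookkeeping). -/
private theorem ite_mul_ite_add {P Q A A' : Prop} [Decidable P] [Decidable Q] [Decidable A]
    [Decidable A'] (hPQ : ¬(P ∧ Q)) :
    (if A then (1 : K) else 0) * (if P then 1 else 0) +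
        (if A' then 1 else 0) * (if Q then 1 else 0) =
      if (P ∧ A) ∨ (Q ∧ A') then 1 else 0 := by
  by_cases hP : P <;> by_cases hQ : Q
  · exact absurd ⟨hP, hQ⟩ hPQ
  all_goals
    by_cases hA : A <;> by_cases hA' : A' <;> simp [hP, hQ, hA, hA']

/-- [folklore] Two exclusive indicators add up to the indicator of the disjunction (bookkeeping). -/
private theorem ite_add_ite_of_not_and {P Q : Prop} [Decidable P] [Decidable Q] (hPQ : ¬(P ∧ Q)) :
    (if P then (1 : K) else 0) + (if Q then 1 else 0) = if P ∨ Q then 1 else 0 := by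
  by_cases hP : P <;> by_cases hQ : Q
  · exact absurd ⟨hP, hQ⟩ hPQ
  all_goals simp [hP, hQ]

/-- [folklore] One step of the carry automaton (bookkeeping case analysis): prepending the digits
`a, i, j` to `p, m, n < b^k`. -/
private theorem addVec_step (k p m n : ℕ) (hp : p < b ^ k) (hm : m < b ^ k) (hn : n < b ^ k)
    (a i j : Fin b) :
    addCore K a (i, j) *ᵥ addVec K (b ^ k) p m n =
      addVec K (b ^ (k + 1)) (a * b ^ k + p) (i * b ^ k + m) (j * b ^ k + n) := by
  have e0 : ((i : ℕ) * b ^ k + m = j * b ^ k + n + (a * b ^ k + p)) ↔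
      (m = n + p ∧ (i : ℕ) = j + a) ∨ (m + b ^ k = n + p ∧ (i : ℕ) = j + a + 1) := by
    rw [show (j : ℕ) * b ^ k + n + (a * b ^ k + p) = (j + a) * b ^ k + (n + p) by ring]
    exact mul_add_eq_iff hm (by omega)
  have e1 : ((i : ℕ) * b ^ k + m + b ^ (k + 1) = j * b ^ k + n + (a * b ^ k + p)) ↔
      (m = n + p ∧ (i : ℕ) + b = j + a) ∨ (m + b ^ k = n + p ∧ (i : ℕ) + b = j + a + 1) := by
    rw [show (i : ℕ) * b ^ k + m + b ^ (k + 1) = (i + b) * b ^ k + m by ring,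
      show (j : ℕ) * b ^ k + n + (a * b ^ k + p) = (j + a) * b ^ k + (n + p) by ring]
    exact mul_add_eq_iff hm (by omega)
  have hPQ : ¬(m = n + p ∧ m + b ^ k = n + p) := by omega
  ext c
  fin_cases c <;>
    simp only [addVec, addCore, Matrix.mulVec, dotProduct, Fin.sum_univ_two, Matrix.of_apply,
      Fin.zero_eta, Fin.mk_one, Fin.isValue, Matrix.cons_val_zero, Matrix.cons_val_one,
      Fin.val_zero, Fin.val_one, mul_zero, mul_one, add_zero]
  · rw [ite_mul_ite_add hPQ]
    exact if_congr e0.symm rfl rfl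
  · rw [ite_mul_ite_add hPQ]
    exact if_congr e1.symm rfl rfl

/-- THE CARRY AUTOMATON DECIDES `m ≡ n + p`: reading the digit triples of `p = m(π)`, `m = m(σ)`,
`n = m(μ)` (`R` digits each, base `b`), the product of the adder cores applied to the initial
state `(1, 0)ᵀ` (no carry into the units digit) is
`(𝟙[m = n + p], 𝟙[m + b^R = n + p])ᵀ` — the unwrapped and the wrapped part of
`𝟙[m ≡ n + p (mod b^R)]`.  [cite: VysotskyRakhuba2022, Lem. 4.2] -/
theorem mulVec_chainProd_addCore : ∀ (R : ℕ) (π σ μ : Fin R → Fin b),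
    TensorTrain.chainProd (fun _ (t : Fin b × (Fin b × Fin b)) => addCore K t.1 t.2) R
        (fun r => (π r, (σ r, μ r))) *ᵥ ![1, 0] =
      addVec K (b ^ R) (quanticsEquiv b R π) (quanticsEquiv b R σ) (quanticsEquiv b R μ)
  | 0, π, σ, μ => by
      ext c
      fin_cases c <;> simp [TensorTrain.chainProd, addVec]
  | R + 1, π, σ, μ => by
      have hπ : π = Fin.cons (α := fun _ => Fin b) (π 0) (Fin.tail π) := (Fin.cons_self_tail π).symm
      have hσ : σ = Fin.cons (α := fun _ => Fin b) (σ 0) (Fin.tail σ) := (Fin.cons_self_tail σ).symm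
      have hμ : μ = Fin.cons (α := fun _ => Fin b) (μ 0) (Fin.tail μ) := (Fin.cons_self_tail μ).symm
      rw [TensorTrain.chainProd_succ_eq_core_mul, ← Matrix.mulVec_mulVec]
      have e1 : TensorTrain.chainProd
            (fun ℓ => (fun (_ : ℕ) (t : Fin b × (Fin b × Fin b)) => addCore K t.1 t.2) (ℓ + 1)) R
            (Fin.tail fun r => (π r, (σ r, μ r))) *ᵥ ![1, 0] =
          addVec K (b ^ R) (quanticsEquiv b R (Fin.tail π)) (quanticsEquiv b R (Fin.tail σ))
            (quanticsEquiv b R (Fin.tail μ)) :=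
        mulVec_chainProd_addCore R (Fin.tail π) (Fin.tail σ) (Fin.tail μ)
      rw [e1]
      conv_rhs => rw [hπ, hσ, hμ]
      rw [val_quanticsEquiv_cons, val_quanticsEquiv_cons, val_quanticsEquiv_cons]
      exact addVec_step R _ _ _ (Fin.isLt _) (Fin.isLt _) (Fin.isLt _) _ _ _

variable (K)

/-- THE SHIFT TENSOR TRAIN: the uniform train on digit TRIPLES `(p_r, (m_r, n_r))` with the
adder cores, left boundary `lb` and right boundary `(1, 0)ᵀ`; for `lb = (1, 1)` it represents the
three-leg shift tensor `(p, m, n) ↦ 𝟙[m ≡ n + p (mod b^R)] = (P^p)(m, n)`, for `lb = (1, 0)`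
its non-periodic part `𝟙[m = n + p]` (`eval_adderTrain`).  All bond dimensions are `2`.
[cite: VysotskyRakhuba2022, Lem. 4.2] -/
def adderTrain (lb : Fin 2 → K) (R : ℕ) : TensorTrain K (Fin b × (Fin b × Fin b)) R :=
  TensorTrain.uniform R 2 (fun _ t => addCore K t.1 t.2) lb ![1, 0]

/-- THE QTT MATRIX TRAIN OF A SHIFT POWER: for a string of exponent digits `a_0 a_1 ⋯` (most
significant first), the uniform train on digit PAIRS with the site-dependent cores
`addCore (a ℓ)`, boundaries `lb`, `(1, 0)ᵀ` — for `b = 2`, `lb = (1, 1)` the representation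
`U_{i_L} ⋈ V_{i_{L-1}} ⋈ ⋯ ⋈ V_{i_2} ⋈ W_{i_1}` of the cited Lemma in uniform form
(`U_a = (1, 1) V_a`, `W_a = V_a (1, 0)ᵀ`: `addU_eq`, `addW_eq`).  [cite: VysotskyRakhuba2022, Lem. 4.2] -/
def shiftPowTrain (lb : Fin 2 → K) (a : ℕ → Fin b) (R : ℕ) : TensorTrain K (Fin b × Fin b) R :=
  TensorTrain.uniform R 2 (fun ℓ p => addCore K (a ℓ) p) lb ![1, 0]

/-- THE CYCLIC PERMUTATION MATRIX `P` of size `N`: ones on the subdiagonal and in the top right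
corner, `P(m, n) = 𝟙[m ≡ n + 1 (mod N)]` (`P x` shifts the entries of `x` down cyclically; every
circulant is `circ(c_0, …, c_{N-1}) = c_0 I + c_1 P + ⋯ + c_{N-1} P^{N-1}`).
[cite: VysotskyRakhuba2022, §4] -/
def cyclicShiftP (N : ℕ) : Matrix (Fin N) (Fin N) K :=
  Matrix.of fun m n : Fin N => if (m : ℕ) = n + 1 ∨ ((n : ℕ) + 1 = N ∧ (m : ℕ) = 0) then 1 else 0

variable {K}

/-- The bond dimensions of the shift tensor train are all `2`.  [cite: VysotskyRakhuba2022, Lem. 4.2] -/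
theorem adderTrain_r (lb : Fin 2 → K) (R ℓ : ℕ) : (adderTrain K lb R (b := b)).r ℓ = 2 := rfl

/-- The bond dimensions of the shift-power train are all `2` ("QTT ranks `(2, 2, …, 2)`").
[cite: VysotskyRakhuba2022, Lem. 4.2] -/
theorem shiftPowTrain_r (lb : Fin 2 → K) (a : ℕ → Fin b) (R ℓ : ℕ) :
    (shiftPowTrain K lb a R).r ℓ = 2 := rfl

/-- THE SHIFT TENSOR HAS TT RANKS TWO: the value of the shift tensor train at the digit triples of
`(p, m, n)` is `lb_0 𝟙[m = n + p] + lb_1 𝟙[m + b^R = n + p]`.  [cite: VysotskyRakhuba2022, Lem. 4.2] -/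
theorem eval_adderTrain (lb : Fin 2 → K) (R : ℕ) (π σ μ : Fin R → Fin b) :
    (adderTrain K lb R).eval (fun r => (π r, (σ r, μ r))) =
      lb 0 * (if (quanticsEquiv b R σ : ℕ) = quanticsEquiv b R μ + quanticsEquiv b R π
          then 1 else 0) +
        lb 1 * (if (quanticsEquiv b R σ : ℕ) + b ^ R = quanticsEquiv b R μ + quanticsEquiv b R π
          then 1 else 0) := by
  rw [adderTrain, TensorTrain.eval_uniform, ← Matrix.dotProduct_mulVec, mulVec_chainProd_addCore]
  simp [addVec, dotProduct, Fin.sum_univ_two]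

/-- [folklore] Subtraction in `Fin N` (it wraps around): `m - n = p ↔ m = n + p ∨ m + N = n + p`
as natural numbers (bookkeeping). -/
private theorem fin_sub_eq_iff {N : ℕ} (m n p : Fin N) :
    m - n = p ↔ (m : ℕ) = n + p ∨ (m : ℕ) + N = n + p := by
  have hm := m.isLt
  have hn := n.isLt
  have hp := p.isLt
  rw [Fin.ext_iff]
  rcases Nat.lt_or_ge (m : ℕ) n with h | h
  · rw [Fin.coe_sub_iff_lt.2 (Fin.lt_def.2 h)]
    omega
  · rw [Fin.coe_sub_iff_le.2 (Fin.le_def.2 h)]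
    omega

/-- THE SHIFT TENSOR, periodic boundary `(1, 1)`: the value at the digit triples of `(p, m, n)` is
`𝟙[m - n = p]` with the difference taken in `ℤ/b^R` (i.e. `(P^p)(m, n)`).
[cite: VysotskyRakhuba2022, Lem. 4.2] -/
theorem eval_adderTrain_periodic (R : ℕ) (π σ μ : Fin R → Fin b) :
    (adderTrain K ![1, 1] R).eval (fun r => (π r, (σ r, μ r))) =
      if quanticsEquiv b R σ - quanticsEquiv b R μ = quanticsEquiv b R π then 1 else 0 := by
  rw [eval_adderTrain]
  simp only [Matrix.cons_val_zero, Matrix.cons_val_one, one_mul, fin_sub_eq_iff]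
  have hn := (quanticsEquiv b R μ).isLt
  exact ite_add_ite_of_not_and (by omega)

/-- The shift-power train is the shift tensor train read along the fixed exponent string
(bookkeeping).  [cite: VysotskyRakhuba2022, Lem. 4.2] -/
theorem eval_shiftPowTrain (lb : Fin 2 → K) (a : ℕ → Fin b) (R : ℕ) (σ μ : Fin R → Fin b) :
    (shiftPowTrain K lb a R).eval (fun r => (σ r, μ r)) =
      (adderTrain K lb R).eval (fun r => (a r, (σ r, μ r))) := by
  rw [shiftPowTrain, adderTrain, TensorTrain.eval_uniform, TensorTrain.eval_uniform,
    TensorTrain.chainProd_curry (addCore K) a]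

/-- THE SHIFT POWERS HAVE QTT RANKS TWO (matrix form, any base, both boundary types): the QTT
matrix of the shift-power train with exponent `p = m(a_0 ⋯ a_{R-1})` is
`lb_0 𝟙[m = n + p] + lb_1 𝟙[m + b^R = n + p]`.  [cite: VysotskyRakhuba2022, Lem. 4.2] -/
theorem qttMatrix_shiftPowTrain (lb : Fin 2 → K) (a : ℕ → Fin b) (R : ℕ) :
    (shiftPowTrain K lb a R).qttMatrix = Matrix.of fun m n : Fin (b ^ R) =>
      lb 0 * (if (m : ℕ) = n + quanticsEquiv b R (fun r => a r) then 1 else 0) +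
        lb 1 * (if (m : ℕ) + b ^ R = n + quanticsEquiv b R (fun r => a r) then 1 else 0) := by
  rw [TensorTrain.qttMatrix_eq_iff]
  intro σ μ
  rw [eval_shiftPowTrain, eval_adderTrain, Matrix.of_apply]

/-- LEMMA 3.2 / 4.2, PERIODIC CASE: with the left boundary `(1, 1)` the shift-power train with
exponent `p` represents the CIRCULANT PERMUTATION MATRIX `P^p = circ(e_p)`,
`(m, n) ↦ 𝟙[m - n = p in ℤ/b^R]`.  [cite: VysotskyRakhuba2022, Lem. 4.2] -/
theorem qttMatrix_shiftPowTrain_periodic (a : ℕ → Fin b) (R : ℕ) :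
    (shiftPowTrain K ![1, 1] a R).qttMatrix =
      Matrix.circulant (Pi.single (quanticsEquiv b R fun r => a r) (1 : K)) := by
  rw [TensorTrain.qttMatrix_eq_iff]
  intro σ μ
  rw [eval_shiftPowTrain, eval_adderTrain_periodic, Matrix.circulant_apply, Pi.single_apply]

/-- LEMMA 3.2 / 4.2, NON-PERIODIC PART: with the left boundary `(1, 0)` the shift-power train
with exponent `p` represents the `p`-th power of the (non-cyclic) down-shift,
`(m, n) ↦ 𝟙[m = n + p]` (cf. `transpose_shiftS_pow`).  [cite: VysotskyRakhuba2022, Lem. 4.2] -/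
theorem qttMatrix_shiftPowTrain_lower (a : ℕ → Fin b) (R : ℕ) :
    (shiftPowTrain K ![1, 0] a R).qttMatrix = Matrix.of fun m n : Fin (b ^ R) =>
      if (m : ℕ) = n + quanticsEquiv b R (fun r => a r) then (1 : K) else 0 := by
  rw [qttMatrix_shiftPowTrain]
  ext m n
  simp

/-- The cyclic permutation matrix is the circulant `circ(e_1)` (for `N = 1` both are `(1)`).
[cite: VysotskyRakhuba2022, §4] -/
theorem cyclicShiftP_eq_circulant (N : ℕ) [NeZero N] :
    cyclicShiftP K N = Matrix.circulant (Pi.single (1 : Fin N) (1 : K)) := by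
  ext m n
  have hm := m.isLt
  have hn := n.isLt
  simp only [cyclicShiftP, Matrix.of_apply, Matrix.circulant_apply, Pi.single_apply, fin_sub_eq_iff,
    Fin.val_one']
  refine if_congr ?_ rfl rfl
  rcases Nat.lt_or_ge 1 N with h1 | h1
  · rw [Nat.mod_eq_of_lt h1]
    omega
  · have hN : N = 1 := le_antisymm h1 (Nat.pos_of_neZero N)
    subst hN
    rw [Nat.mod_self]
    omega

open Fin.NatCast in
/-- Powers of `circ(e_1)` are the circulants `circ(e_k)`: `P^k(m, n) = 𝟙[m - n = k in ℤ/N]`.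
[cite: VysotskyRakhuba2022, §4] -/
theorem circulant_single_one_pow (N : ℕ) [NeZero N] : ∀ k : ℕ,
    Matrix.circulant (Pi.single (1 : Fin N) (1 : K)) ^ k =
      Matrix.circulant (Pi.single (k : Fin N) (1 : K))
  | 0 => by rw [pow_zero, Nat.cast_zero, Matrix.circulant_single_one]
  | k + 1 => by
      rw [pow_succ, circulant_single_one_pow N k, Matrix.circulant_mul, Matrix.mulVec_single_one,
        Nat.cast_succ]
      congr 1
      ext i
      simp [Matrix.col, Matrix.circulant_apply, Pi.single_apply, sub_eq_iff_eq_add]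

open Fin.NatCast in
/-- `P^p` is the circulant `circ(e_p)`.  [cite: VysotskyRakhuba2022, §4] -/
theorem cyclicShiftP_pow (N : ℕ) [NeZero N] (p : Fin N) :
    cyclicShiftP K N ^ (p : ℕ) = Matrix.circulant (Pi.single p (1 : K)) := by
  rw [cyclicShiftP_eq_circulant, circulant_single_one_pow, Fin.cast_val_eq_self]

/-- LEMMA 3.2 OF KAZEEV–KHOROMSKIJ–TYRTYSHNIKOV = LEMMA 4.2 OF VYSOTSKY–RAKHUBA (any base `b ≥ 1`,
uniform form): THE `p`-TH POWER OF THE CYCLIC PERMUTATION MATRIX OF SIZE `b^R` IS THE QTT MATRIX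
OF THE RANK-`2` TRAIN with cores `addCore (a ℓ)` along the digits `a_0 a_1 ⋯ a_{R-1}` of `p`
(most significant first) and boundaries `(1, 1)`, `(1, 0)ᵀ`.  [cite: VysotskyRakhuba2022, Lem. 4.2] -/
theorem qttMatrix_shiftPowTrain_eq_pow [NeZero b] (a : ℕ → Fin b) (R : ℕ) :
    (shiftPowTrain K ![1, 1] a R).qttMatrix =
      cyclicShiftP K (b ^ R) ^ (quanticsEquiv b R (fun r => a r) : ℕ) := by
  rw [qttMatrix_shiftPowTrain_periodic, cyclicShiftP_pow]

/-- The shift tensor read at the digit triples of `(p, m, n)` is the entry `(P^p)(m, n)`.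
[cite: VysotskyRakhuba2022, Lem. 4.2] -/
theorem eval_adderTrain_periodic_eq_pow_apply [NeZero b] (R : ℕ) (π σ μ : Fin R → Fin b) :
    (adderTrain K ![1, 1] R).eval (fun r => (π r, (σ r, μ r))) =
      (cyclicShiftP K (b ^ R) ^ (quanticsEquiv b R π : ℕ)) (quanticsEquiv b R σ)
        (quanticsEquiv b R μ) := by
  rw [eval_adderTrain_periodic, cyclicShiftP_pow, Matrix.circulant_apply, Pi.single_apply]

end ShiftPowers

/-! ### The non-periodic part as a matrix power -/

section NonPeriodic

variable {K : Type u} [CommRing K] {b : ℕ}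

/-- The powers of the non-cyclic down-shift `Sᵀ` (`S` = ones on the superdiagonal,
`Literature.LinearAlgebra.TensorNetworks.shiftS`): `(Sᵀ)^p (m, n) = 𝟙[m = n + p]`, the matrix
of `qttMatrix_shiftPowTrain_lower`.  [cite: KazeevKhoromskij2012, §1.2] -/
theorem transpose_shiftS_pow (N : ℕ) : ∀ p : ℕ,
    ((shiftS K N)ᵀ) ^ p = Matrix.of fun m n : Fin N => if (m : ℕ) = n + p then (1 : K) else 0
  | 0 => by
      ext m n
      simp [Matrix.one_apply, Fin.ext_iff]
  | p + 1 => by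
      rw [pow_succ, transpose_shiftS_pow N p]
      ext m n
      have hm := m.isLt
      have hn := n.isLt
      simp only [Matrix.mul_apply, Matrix.of_apply, Matrix.transpose_apply, shiftS]
      by_cases h : (n : ℕ) + 1 < N
      · rw [Finset.sum_eq_single ⟨(n : ℕ) + 1, h⟩]
        · dsimp only
          split_ifs <;> (try simp) <;> omega
        · intro k _ hk
          have hk' : (k : ℕ) ≠ n + 1 := fun e => hk (Fin.ext e)
          simp [hk']
        · intro habs
          exact absurd (Finset.mem_univ _) habs
      · rw [Finset.sum_eq_zero, if_neg (by omega)]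
        intro k _
        have hk := k.isLt
        have hk' : (k : ℕ) ≠ n + 1 := by omega
        simp [hk']

/-- LEMMA 3.2 / 4.2, NON-PERIODIC PART, as a matrix power: with the left boundary `(1, 0)` the
shift-power train represents `(Sᵀ)^p`.  [cite: VysotskyRakhuba2022, Lem. 4.2] -/
theorem qttMatrix_shiftPowTrain_eq_transpose_shiftS_pow (a : ℕ → Fin b) (R : ℕ) :
    (shiftPowTrain K ![1, 0] a R).qttMatrix =
      ((shiftS K (b ^ R))ᵀ) ^ (quanticsEquiv b R (fun r => a r) : ℕ) := by
  rw [qttMatrix_shiftPowTrain_lower, transpose_shiftS_pow]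

end NonPeriodic

/-! ### Lemma 3.2 / 4.2 verbatim: the binary blocks `U_a`, `V_a`, `W_a` -/

section Binary

variable (K : Type u) [CommRing K]

/-- The block `H = J + J' = [0 1; 1 0]` of the first cores `U_0 = [I H]`, `U_1 = [H I]` (used but
not displayed in the quoting text; this is the reading certified by `vecMul_addCore_two_zero` /
`_one`).  [cite: VysotskyRakhuba2022, Lem. 4.2] -/
def blkH (p : Fin 2 × Fin 2) : K := blkJ K p + blkJ' K p

/-- The first core `U_{i_L}` VERBATIM: `U_0 = [I H]`, `U_1 = [H I]` (a `1 × 2` block row).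
[cite: VysotskyRakhuba2022, Lem. 4.2] -/
def addU (a : Fin 2) (p : Fin 2 × Fin 2) : Matrix (Fin 1) (Fin 2) K :=
  if a = 0 then !![blkI K p, blkH K p] else !![blkH K p, blkI K p]

/-- The middle cores `V_{i_k}` VERBATIM: `V_0 = [I J'; 0 J]`, `V_1 = [J' 0; J I]`.
[cite: VysotskyRakhuba2022, Lem. 4.2] -/
def addV (a : Fin 2) (p : Fin 2 × Fin 2) : Matrix (Fin 2) (Fin 2) K :=
  if a = 0 then !![blkI K p, blkJ' K p; 0, blkJ K p] else !![blkJ' K p, 0; blkJ K p, blkI K p]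

/-- The last core `W_{i_1}` VERBATIM: `W_0 = [I; 0]`, `W_1 = [J'; J]` (a `2 × 1` block column).
[cite: VysotskyRakhuba2022, Lem. 4.2] -/
def addW (a : Fin 2) (p : Fin 2 × Fin 2) : Matrix (Fin 2) (Fin 1) K :=
  if a = 0 then !![blkI K p; 0] else !![blkJ' K p; blkJ K p]

variable {K}

/-- `V_0 = [I J'; 0 J]` is the adder core at the exponent digit `0` (base `2`).
[cite: VysotskyRakhuba2022, Lem. 4.2] -/
theorem addCore_two_zero (p : Fin 2 × Fin 2) :
    addCore K (0 : Fin 2) p = !![blkI K p, blkJ' K p; 0, blkJ K p] := by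
  obtain ⟨i, j⟩ := p
  ext c' c
  fin_cases c' <;> fin_cases c <;> fin_cases i <;> fin_cases j <;> simp [addCore, blkI, blkJ, blkJ']

/-- `V_1 = [J' 0; J I]` is the adder core at the exponent digit `1` (base `2`).
[cite: VysotskyRakhuba2022, Lem. 4.2] -/
theorem addCore_two_one (p : Fin 2 × Fin 2) :
    addCore K (1 : Fin 2) p = !![blkJ' K p, 0; blkJ K p, blkI K p] := by
  obtain ⟨i, j⟩ := p
  ext c' c
  fin_cases c' <;> fin_cases c <;> fin_cases i <;> fin_cases j <;> simp [addCore, blkI, blkJ, blkJ']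

/-- The verbatim middle cores are the adder cores.  [cite: VysotskyRakhuba2022, Lem. 4.2] -/
theorem addV_eq (a : Fin 2) (p : Fin 2 × Fin 2) : addV K a p = addCore K a p := by
  obtain ⟨i, j⟩ := p
  ext c' c
  fin_cases a <;> fin_cases c' <;> fin_cases c <;> fin_cases i <;> fin_cases j <;>
    simp [addV, addCore, blkI, blkJ, blkJ']

/-- `U_0 = [I H] = (1, 1) · V_0` with `H = J + J'`.  [cite: VysotskyRakhuba2022, Lem. 4.2] -/
theorem vecMul_addCore_two_zero (p : Fin 2 × Fin 2) :
    ![(1 : K), 1] ᵥ* addCore K (0 : Fin 2) p = ![blkI K p, blkJ K p + blkJ' K p] := by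
  obtain ⟨i, j⟩ := p
  ext c
  fin_cases c <;> fin_cases i <;> fin_cases j <;>
    simp [addCore, blkI, blkJ, blkJ', Matrix.vecMul, dotProduct, Fin.sum_univ_two]

/-- `U_1 = [H I] = (1, 1) · V_1` with `H = J + J'`.  [cite: VysotskyRakhuba2022, Lem. 4.2] -/
theorem vecMul_addCore_two_one (p : Fin 2 × Fin 2) :
    ![(1 : K), 1] ᵥ* addCore K (1 : Fin 2) p = ![blkJ K p + blkJ' K p, blkI K p] := by
  obtain ⟨i, j⟩ := p
  ext c
  fin_cases c <;> fin_cases i <;> fin_cases j <;>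
    simp [addCore, blkI, blkJ, blkJ', Matrix.vecMul, dotProduct, Fin.sum_univ_two]

/-- `W_0 = [I; 0] = V_0 · (1, 0)ᵀ`.  [cite: VysotskyRakhuba2022, Lem. 4.2] -/
theorem addCore_two_zero_mulVec (p : Fin 2 × Fin 2) :
    addCore K (0 : Fin 2) p *ᵥ ![1, 0] = ![blkI K p, 0] := by
  obtain ⟨i, j⟩ := p
  ext c
  fin_cases c <;> fin_cases i <;> fin_cases j <;>
    simp [addCore, blkI, Matrix.mulVec, dotProduct, Fin.sum_univ_two]

/-- `W_1 = [J'; J] = V_1 · (1, 0)ᵀ`.  [cite: VysotskyRakhuba2022, Lem. 4.2] -/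
theorem addCore_two_one_mulVec (p : Fin 2 × Fin 2) :
    addCore K (1 : Fin 2) p *ᵥ ![1, 0] = ![blkJ' K p, blkJ K p] := by
  obtain ⟨i, j⟩ := p
  ext c
  fin_cases c <;> fin_cases i <;> fin_cases j <;>
    simp [addCore, blkJ, blkJ', Matrix.mulVec, dotProduct, Fin.sum_univ_two]

/-- The verbatim first core is `(1, 1) ⋈ V_a` (bookkeeping).  [cite: VysotskyRakhuba2022, Lem. 4.2] -/
theorem addU_eq (a : Fin 2) (p : Fin 2 × Fin 2) :
    addU K a p = Matrix.of fun (_ : Fin 1) c => (![(1 : K), 1] ᵥ* addCore K a p) c := by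
  obtain ⟨i, j⟩ := p
  ext r c
  fin_cases r; fin_cases a <;> fin_cases c <;> fin_cases i <;> fin_cases j <;>
    simp [addU, blkH, addCore, blkI, blkJ, blkJ', Matrix.vecMul, dotProduct, Fin.sum_univ_two]

/-- The verbatim last core is `V_a ⋈ (1, 0)ᵀ` (bookkeeping).  [cite: VysotskyRakhuba2022, Lem. 4.2] -/
theorem addW_eq (a : Fin 2) (p : Fin 2 × Fin 2) :
    addW K a p = Matrix.of fun c' (_ : Fin 1) => (addCore K a p *ᵥ ![1, 0]) c' := by
  obtain ⟨i, j⟩ := p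
  ext c r
  fin_cases r; fin_cases a <;> fin_cases c <;> fin_cases i <;> fin_cases j <;>
    simp [addW, addCore, blkI, blkJ, blkJ', Matrix.mulVec, dotProduct, Fin.sum_univ_two]

/-- [folklore] The entry of `row · M · column` is the bilinear pairing (bookkeeping). -/
private theorem row_mul_mul_col_apply₃ {n : ℕ} (u v : Fin n → K) (M : Matrix (Fin n) (Fin n) K) :
    (Matrix.of (fun (_ : Fin 1) j => u j) * M * Matrix.of (fun i (_ : Fin 1) => v i)) 0 0 =
      u ᵥ* M ⬝ᵥ v := by
  simp only [Matrix.mul_apply, Matrix.vecMul, dotProduct, Matrix.of_apply]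

/-- LEMMA 4.2 OF VYSOTSKY–RAKHUBA (= LEM. 3.2 OF KAZEEV–KHOROMSKIJ–TYRTYSHNIKOV) VERBATIM
(`L = k + 2 ≥ 2`): for the binary digits `i_L ⋯ i_1` of the exponent `i = 2^{L-1} i_L + ⋯ + i_1`
and the row/column digit pairs of `(m, n)` (most significant first), the unique entry of the
`1 × 1` matrix `U_{i_L}(m_1,n_1) · V_{i_{L-1}}(m_2,n_2) ⋯ V_{i_2}(m_{L-1},n_{L-1}) · W_{i_1}(m_L,n_L)`
— the `((m_1…m_L), (n_1…n_L))` block entry of the strong Kronecker product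
`U_{i_L} ⋈ V_{i_{L-1}} ⋈ ⋯ ⋈ V_{i_2} ⋈ W_{i_1}` — is `(P_L^i)(m, n)`.
[cite: VysotskyRakhuba2022, Lem. 4.2] -/
theorem pow_cyclicShiftP_eq_addU_mul_chainProd_mul_addW (k : ℕ) (π σ μ : Fin (k + 2) → Fin 2) :
    (addU K (π 0) (σ 0, μ 0) *
        TensorTrain.chainProd (fun _ (t : Fin 2 × (Fin 2 × Fin 2)) => addV K t.1 t.2) k
          (fun r : Fin k => (π r.succ.castSucc, (σ r.succ.castSucc, μ r.succ.castSucc))) *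
        addW K (π (Fin.last (k + 1))) (σ (Fin.last (k + 1)), μ (Fin.last (k + 1)))) 0 0 =
      (cyclicShiftP K (2 ^ (k + 2)) ^ (quanticsEquiv 2 (k + 2) π : ℕ))
        (quanticsEquiv 2 (k + 2) σ) (quanticsEquiv 2 (k + 2) μ) := by
  rw [← eval_adderTrain_periodic_eq_pow_apply, adderTrain, TensorTrain.eval_uniform,
    TensorTrain.chainProd, TensorTrain.chainProd_succ_eq_mul, addU_eq, addW_eq,
    row_mul_mul_col_apply₃]
  simp only [addV_eq, ← Matrix.vecMul_vecMul, Matrix.dotProduct_mulVec]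
  rfl

end Binary

/-! ### Circulant and Toeplitz matrices generated by QTT vectors have QTT ranks `2r` -/

section Circulant

variable {K : Type u} [CommSemiring K] {b R : ℕ}

/-- THE TOEPLITZ MATRIX with lower generator `c` and upper generator `u`:
`T(m, n) = c_{m-n}` for `m ≥ n` and `T(m, n) = u_{N+m-n}` for `m < n` (both written with the
wrap-around difference `m - n ∈ ℤ/N`; `u_0` is not used); `circ(x) = toeplitz x x`.
[cite: VysotskyRakhuba2022, §1] -/
def toeplitz {N : ℕ} (c u : Fin N → K) : Matrix (Fin N) (Fin N) K :=
  Matrix.of fun m n => if n ≤ m then c (m - n) else u (m - n)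

omit [CommSemiring K] in
/-- A circulant is the Toeplitz matrix whose two generators coincide.  [cite: VysotskyRakhuba2022, §1] -/
theorem toeplitz_self {N : ℕ} (x : Fin N → K) : toeplitz x x = Matrix.circulant x := by
  ext m n
  simp [toeplitz, Matrix.circulant_apply]

/-- The bond dimensions of `x ×₁ (shift tensor)` are `2 r_ℓ` ("an explicit QTT representation
with all ranks equal to `2r`").  [cite: VysotskyRakhuba2022, §8 (proof of Prop. 4.1)] -/
theorem contract_adderTrain_r (X : TensorTrain K (Fin b) R) (lb : Fin 2 → K) (ℓ : ℕ) :
    (X.contract (adderTrain K lb R)).r ℓ = X.r ℓ * 2 := rfl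

/-- [folklore] `m = n + p` in `ℕ` means `n ≤ m` and `m - n = p` in `Fin N` (bookkeeping). -/
private theorem eq_add_iff_le_and_sub_eq {N : ℕ} (m n p : Fin N) :
    (m : ℕ) = n + p ↔ n ≤ m ∧ m - n = p := by
  have hm := m.isLt
  have hp := p.isLt
  rw [Fin.ext_iff, Fin.le_def]
  constructor
  · intro h
    have hle : n ≤ m := Fin.le_def.2 (by omega)
    rw [Fin.coe_sub_iff_le.2 hle]
    omega
  · rintro ⟨hle, h⟩
    rw [Fin.coe_sub_iff_le.2 (Fin.le_def.2 hle)] at h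
    omega

/-- [folklore] `m + N = n + p` in `ℕ` means `m < n` and `m - n = p` in `Fin N` (bookkeeping). -/
private theorem add_eq_add_iff_lt_and_sub_eq {N : ℕ} (m n p : Fin N) :
    (m : ℕ) + N = n + p ↔ m < n ∧ m - n = p := by
  have hn := n.isLt
  have hp := p.isLt
  rw [Fin.ext_iff, Fin.lt_def]
  constructor
  · intro h
    have hlt : m < n := Fin.lt_def.2 (by omega)
    rw [Fin.coe_sub_iff_lt.2 hlt]
    omega
  · rintro ⟨hlt, h⟩
    rw [Fin.coe_sub_iff_lt.2 (Fin.lt_def.2 hlt)] at h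
    omega

/-- THE MATRIX GENERATED BY A QTT VECTOR AND THE SHIFT TENSOR: for a QTT vector `x` (train `X` on
digit legs) the contraction `x ×₁ (shift tensor with left boundary lb)` represents
`(m, n) ↦ lb_0 · [n ≤ m] x_{m-n} + lb_1 · [m < n] x_{m-n}` (difference in `ℤ/b^R`): `Σ_p x_p` times
the unwrapped resp. wrapped part of `𝟙[m - n = p]`.  [cite: VysotskyRakhuba2022, §8 (proof of Prop. 4.1)] -/
theorem qttMatrix_contract_adderTrain (X : TensorTrain K (Fin b) R) (lb : Fin 2 → K) :
    (X.contract (adderTrain K lb R)).qttMatrix = Matrix.of fun m n : Fin (b ^ R) =>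
      lb 0 * (if n ≤ m then X.eval ((quanticsEquiv b R).symm (m - n)) else 0) +
        lb 1 * (if m < n then X.eval ((quanticsEquiv b R).symm (m - n)) else 0) := by
  rw [TensorTrain.qttMatrix_eq_iff]
  intro σ μ
  rw [TensorTrain.eval_contract, Matrix.of_apply, ← (quanticsEquiv b R).symm.sum_comp]
  simp only [eval_adderTrain, Equiv.apply_symm_apply, eq_add_iff_le_and_sub_eq,
    add_eq_add_iff_lt_and_sub_eq, mul_add, Finset.sum_add_distrib]
  congr 1
  · by_cases h : quanticsEquiv b R μ ≤ quanticsEquiv b R σ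
    · simp [h, mul_ite, mul_comm]
    · simp [h]
  · by_cases h : quanticsEquiv b R σ < quanticsEquiv b R μ
    · simp [h, mul_ite, mul_comm]
    · simp [h]

/-- CIRCULANT MATRICES GENERATED BY QTT VECTORS ([KazeevKhoromskijTyrtyshnikov2013] as used in
§8 of the cited paper, proof of Prop. 4.1): if `x ∈ K^{b^R}` is represented by a train with bond
dimensions `r_ℓ`, then `circ(x) = Σ_p x_p P^p = x ×₁ (shift tensor)` is represented by the
contracted train, bond dimensions `2 r_ℓ` (`contract_adderTrain_r`).
[cite: VysotskyRakhuba2022, §8 (proof of Prop. 4.1)] -/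
theorem qttMatrix_contract_adderTrain_periodic (X : TensorTrain K (Fin b) R) :
    (X.contract (adderTrain K ![1, 1] R)).qttMatrix =
      Matrix.circulant fun p => X.eval ((quanticsEquiv b R).symm p) := by
  rw [qttMatrix_contract_adderTrain]
  ext m n
  simp only [Matrix.of_apply, Matrix.circulant_apply, Matrix.cons_val_zero, Matrix.cons_val_one,
    one_mul]
  by_cases h : n ≤ m
  · simp [h, not_lt.2 h]
  · simp [h, not_le.1 h]

/-- The LOWER TRIANGULAR TOEPLITZ matrix generated by a QTT vector `c` (left boundary `(1, 0)`):
`(m, n) ↦ [n ≤ m] c_{m-n}`, bond dimensions `2 r_ℓ`.  [cite: VysotskyRakhuba2022, §8 (proof of Prop. 4.1)] -/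
theorem qttMatrix_contract_adderTrain_lower (X : TensorTrain K (Fin b) R) :
    (X.contract (adderTrain K ![1, 0] R)).qttMatrix = Matrix.of fun m n : Fin (b ^ R) =>
      if n ≤ m then X.eval ((quanticsEquiv b R).symm (m - n)) else 0 := by
  rw [qttMatrix_contract_adderTrain]
  ext m n
  simp

/-- The STRICTLY UPPER TRIANGULAR part of the circulant generated by a QTT vector `u` (left
boundary `(0, 1)`, the wrapped part of the shift tensor): `(m, n) ↦ [m < n] u_{N+m-n}`, bond
dimensions `2 r_ℓ`.  [cite: VysotskyRakhuba2022, §8 (proof of Prop. 4.1)] -/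
theorem qttMatrix_contract_adderTrain_upper (X : TensorTrain K (Fin b) R) :
    (X.contract (adderTrain K ![0, 1] R)).qttMatrix = Matrix.of fun m n : Fin (b ^ R) =>
      if m < n then X.eval ((quanticsEquiv b R).symm (m - n)) else 0 := by
  rw [qttMatrix_contract_adderTrain]
  ext m n
  simp

/-- TOEPLITZ MATRICES GENERATED BY QTT VECTORS: the Toeplitz matrix with lower generator `c` and
upper generator `u`, given as QTT vectors with bond dimensions `r_ℓ(c)`, `r_ℓ(u)`, is represented by
the sum of the two contracted trains, bond dimensions `2 r_ℓ(c) + 2 r_ℓ(u)` (`toeplitzTrain_r`).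
[cite: VysotskyRakhuba2022, §8 (proof of Prop. 4.1)] -/
theorem qttMatrix_toeplitzTrain (C U : TensorTrain K (Fin b) R) :
    ((C.contract (adderTrain K ![1, 0] R)).add (U.contract (adderTrain K ![0, 1] R))).qttMatrix =
      toeplitz (fun p => C.eval ((quanticsEquiv b R).symm p))
        (fun p => U.eval ((quanticsEquiv b R).symm p)) := by
  rw [TensorTrain.qttMatrix_eq_iff]
  intro σ μ
  rw [TensorTrain.eval_add, ← TensorTrain.qttMatrix_apply, ← TensorTrain.qttMatrix_apply,
    qttMatrix_contract_adderTrain_lower, qttMatrix_contract_adderTrain_upper]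
  simp only [Matrix.of_apply, toeplitz]
  by_cases h : quanticsEquiv b R μ ≤ quanticsEquiv b R σ
  · simp [h, not_lt.2 h]
  · simp [h, not_le.1 h]

/-- The bond dimensions of the Toeplitz train are `2 r_ℓ(c) + 2 r_ℓ(u)`.
[cite: VysotskyRakhuba2022, §8 (proof of Prop. 4.1)] -/
theorem toeplitzTrain_r (C U : TensorTrain K (Fin b) R) (ℓ : ℕ) :
    ((C.contract (adderTrain K ![1, 0] R)).add (U.contract (adderTrain K ![0, 1] R))).r ℓ =
      C.r ℓ * 2 + U.r ℓ * 2 := rfl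

end Circulant

end Literature.LinearAlgebra.TensorNetworks
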